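import Summits.QuantumFields.YangMills.Theorems.BalabanUVNodesN19RateEdge
import Summits.QuantumFields.YangMills.Theorems.BalabanUVNodesN19InEdgesAtRecord

/-!
# BalabanUVNodes ∕ N19 — the N19′ «RATE EDGE» AT THE TWO CARRIER RECORDS WITH THE IN-EDGES CONSUMED BY NAME: `RatesAt D R` read at
# N14 · N16 · N17 · N18 · N22 (five of six; `N15At` = NE2 has no consumer in the tree's N19 chain), the two displayed liaison readings of
# `N19RateEdge.rateEdge_of_linkReading` (p421499) REPLACED by the consumer-side conversions of `N19InEdgesAtRecord` (seat dag-n19-a gen 4; count-neutral)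

WHY.  Gen 3's edge `rateEdge_of_linkReading` produces n27-a's top-join hypothesis «`SRec … S → RRec … R → RatesAt D R → ∃ δ, NE7.Core (S-cores) δ ∧
Summable δ`» (`BalabanUVNodesN27SpineRecord.coreEdge_of_rateEdge`) from a LINK READING of `(S, R)`, consuming `N14At R.ne1`, `N18At R.u3`, `N22At R.u3`
BY NAME but reading N16 and N17 through DISPLAYED liaison hypotheses (`NE3Shape Rd C₃ θ₃ ∧ GaugeDominated Rd uA uB`; node U2's output `InjectedRate
Cd 0 θc disc`).  Referee pin [DAGREFB-G5-READ-269] (pub-ymgap INBOX l.11098): «the liaison conversions … are still to be applied at the record».  THIS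
FILE does so — `rateEdge_of_linkReading_byName` has the SAME conclusion and the same link reading EXCEPT that clause (v) now lists, in place of the two
liaison readings, the inputs of `N19InEdgesAtRecord.ne3Liaison_of_covRoot` (THE END's regime letters of `R.ne3` with `R.ne3.g = gradConst 4 c′`, N07's
interface `LeafH3sup`, the record's regular minimiser selection, the reading map `rd`, NE7 route-#1's numeric side letters, the offset, the
gauge-domination convention, the action-reading identification, `Nper⁴ ≤ Rd.vol`, `L⁻¹, θ⁸ ≤ θ₃`) and of `N19InEdgesAtRecord.injectedRate_of_n17At_readOutAt`
(the (0.20)-run identification `∀ K, RGEqH K D.βfun (g K)`, the infrared pin, (D4) `ReadOutAt D R.u3`, the eventual lower bound `EventualLowerH b R.u3.γ k₀β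
D.βfun`, the smallness window, `0 < R.u3.ρ < 1`, `R.u3.ρ ≤ θc`), whereupon `N16At R.ne3` and `N17At D R.u3` are CONSUMED from `RatesAt D R` by name
(`hrates.2.2.1`, `hrates.2.2.2.1`) next to N14 · N18 · N22.  The K5 stub under the interim pin is then ONE application of gen 3's §3:
`N19RateEdge.s_N19_rateInputs_of_rateEdge SRec RRec hpin (rateEdge_of_linkReading_byName SRec RRec hlink)` (not restated: 400-line rule).
PROOF NOTE.  The link reading is destructured IN STAGES of ≤ 20 components — a single flat `obtain` over the 113-component telescope is quadratic in
the pattern count (≈ 14 min on the farm against ≈ 15 s staged).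

WHAT REMAINS DISPLAYED (census of the edge after this file): (F) the (2.25) term format ∕ reference ledger ∕ booking ∕ other kinds (`LedgerAtSync`, NODE O);
the identifications (v-A)(v-B)(d)(m) + first-coupling recovery; [III] Thm 2 (2.43) AS PRINTED (`B14.Thm2Printed`, N11's leaf) and N14's positional
counts; the bracket (T) (`LipBackground` + `PolyLipGrowth`, printed-grade — v7 derives it from (2.27)(ii)–(2.28)+(2.6)); N07's interface (H3ˢᵘᵖ); the
OBJECT-bound conventions of this file's clause (v′) ((0.20)-run identification, IR pin, reading map, minimiser selection, action-reading identification,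
gauge domination); the β-window letters `EventualLowerH` (N25 ∕ B3 side) and (D4); `N15At` unconsumed (NE2 feeds NE3's PRODUCER side, not N19).

HONEST FRAMING.  Count-neutral kernel bookkeeping; NE7 NOT PRINTED ∕ NOT proved; `SRec`, `RRec` are PARAMETERS (no carrier of record exists in the tree);
nothing of Bałaban's is asserted or instantiated; N19 NOT discharged; one finite four-torus at fixed ε, rung (B)+1 — NOT infinite volume, NOT OS on ℝ⁴,
NOT a mass gap, NOT Clay.  THEOREMS ONLY; 0 `def`; 0 `sorry`; standard axioms.  Supersedes nothing (p421499 stays the displayed-liaison form).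
-/

set_option autoImplicit false

noncomputable section

open Finset MeasureTheory
open scoped BigOperators Matrix Matrix.Norms.L2Operator

namespace Summit.QuantumFields.YangMills.BalabanUVNodes.N19RateEdgeByName

open Literature.MathematicalPhysics.QuantumFieldTheory.Balaban1983to89
open T4OutputRate T4RecentScale T4GoodClassBudget T4CauchySum T4TowerRateComposition T4TowerRateDischarge
open T4EtaRateMin (Readings NE3Shape)
open T4RateLiaison (GaugeDominated)
open T4CouplingMatching (EventualLowerH)
open FlowStep (RGEqH)
open TreeLengthTorus (TFaceConnected torusTreeLen)
open B12TreeDecay (kappa₀)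
open Summit.QuantumFields.BalabanUV.T4Continuum
open AveragingDeficitDualResidual (dualC1 dualC2)
open AveragingDeficitDerivWallProof (wallConst)
open AveragingDeficitPeriodicCounting (IsPeriodicDir)
open MinimalActionSandwich (IsMinimiser minAct)
open MinimalActionRate (sfClass)
open MinimalActionRefine (RegularSup gradConst)
open NE3EnergyShapes (IsUnitarySite IsPeriodicSite)
open NE3.LeafIndexSockets (LeafH3sup)
open Summit.QuantumFields.BalabanUV.T4Continuum.Spine
open Summit.QuantumFields.BalabanUV.T4Continuum.NE1p.DressedRoot (DressedTower DressedStabilityStrict)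
open Summit.QuantumFields.YangMills.BalabanUVNodes.N19LedgerLinkSync (LedgerDataSync LedgerAtSync)
open Summit.QuantumFields.YangMills.BalabanUVNodes.N19MultiplicityByName (core_summable_of_ledgerAtSync_multByName)
open Summit.QuantumFields.YangMills.BalabanUVNodes.N19AtSpineCarriers (deltaOfRecord)
open Summit.QuantumFields.YangMills.BalabanUVNodes.N19RateEdge (ne5_of_n18At dressedStabilityStrict_of_n14At s_N19_rateInputs_of_rateEdge)
open Summit.QuantumFields.YangMills.BalabanUVNodes.N19InEdgesAtRecord (ledgerAtSync_withLoc ne3Liaison_of_covRoot injectedRate_of_n17At_readOutAt)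
open YMDAG.UVSplit (SpineCarriers SpineRecordPred U3Carriers RateCarriers RateRecordPred N14At N18At N22At RatesAt RateInputs S_N19 ReadOutAt)

/-! ## §1 The rate edge with N14 · N16 · N17 · N18 · N22 consumed from `RatesAt D R` by name -/

section Edge

variable {N : ℕ} [NeZero N]

/-- **THE N19′ RATE EDGE AT THE TWO CARRIER RECORDS, IN-EDGES BY NAME** [bookkeeping].  IF the record predicates hand, for every pair `(S, R)` they pin,
the LINK READING of `N19RateEdge.rateEdge_of_linkReading` with clause (v) replaced by (v′): THE END's regime letters of `R.ne3` (`R.ne3.g = gradConst 4 c′`,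
`2 ≤ L`, `1 ≤ Nper`, radii and numerals of `N16Shape.ne3Shape_of_n16`, `dom ⊆ sfClass 4 L Nper ε₁ 0`), N07's interface `LeafH3sup 4 L Nper ε b c′ dom`, a
regular minimiser selection `sel`, NE7 route-#1's side letters (`θ⁶ = L⁻¹`, `γ₃`, `l₁`, fit), rate compatibilities `L⁻¹ ≤ θ₃`, `θ⁸ ≤ θ₃ < 1`, a reading map
`rd` (`rd v ∈ dom`), the action-reading identification `Rd.act k v = minAct … k (rd v)`, `Nper⁴ ≤ Rd.vol`, an offset `k₀ ≥ 1`, the gauge-domination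
convention; letter signs; the (0.20)-run identification `∀ K, RGEqH K D.βfun (g K)`, the infrared pin `g K K = gIR`, (D4) `ReadOutAt D R.u3`, `0 < b`,
`EventualLowerH b R.u3.γ k₀β D.βfun`, the window `cr·C₉·ω·((k₀β+1)γ³ + 2γ∕b) ≤ (1−ρ)∕2`, `0 < R.u3.ρ < 1`, `0 < R.u3.γ`, `R.u3.ρ ≤ θc`; the box; (T); window
memberships; selector compatibility — THEN for all `F D g₀ os S R`: `SRec … S → RRec … R → RatesAt D R → ∃ δ, NE7.Core S.l₀ S.vol S.T S.Bad (A − shA)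
(B − shB) δ ∧ Summable δ`, with `RatesAt D R` consumed at N14 (`.1`), N16 (`.2.2.1`, via `ne3Liaison_of_covRoot`), N17 (`.2.2.2.1`, via
`injectedRate_of_n17At_readOutAt`), N18 (`.2.2.2.2.1`, at the selected first coupling), N22 (`.2.2.2.2.2`) BY NAME; knit v6
`core_summable_of_ledgerAtSync_multByName` on the re-localised readings family (`ledgerAtSync_withLoc`).  NOT NE7; N19 NOT discharged. [folklore] -/
theorem rateEdge_of_linkReading_byName (SRec : SpineRecordPred N) (RRec : RateRecordPred N)
    (hlink : ∀ (F : T4Continuum.T4Family) (D : YMDAG.UVSplit.Datum F N) (g₀ : ℕ → ℝ) (os : List (T4Continuum.ULoop F))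
      (S : SpineCarriers) (R : RateCarriers N), SRec F D g₀ os S → RRec F D g₀ os R → letI := S.dec
      ∃ (_ : DecidableEq R.u3.C.Dom) (F' : Type) (ι' X' : Type) (_ : MeasurableSpace ι')
        (L : LedgerDataSync R.u3.C F' ι' S.ι) (Rd : Readings ι' X') (bsel : (ℕ → ℝ) → ℝ) (EB : Functional R.u3.C R.u3.C.BgB)
        (θc θ₃ Pg : ℝ) (q : ℕ) (CU : (ℕ → ℝ) → ℕ → ℝ) (g : ℕ → ℕ → ℝ)
        (uA : ℕ → ι' → R.u3.C.BgA) (uB : ℕ → ι' → R.u3.C.BgB)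
        (Pf : ℕ → Params) (d₀ L₀ Koff : ℕ) (cells : (K j : ℕ) → R.u3.C.Dom → Finset (Site (Pf K) j))
        (H033 : Flow → ℕ → Prop) (I : Type) (fam : I → B14.Sect2Data) (Lb β : ℝ) (κ₁ : ℕ) (Gv Cl : ℝ) (K₁ : ℕ)
        (Λ₀ N₀ : ℝ) (dressed : R.u3.C.Dom → Prop) (_ : DecidablePred dressed)
        -- N16-side letters: regime, selection, reading map, NE7 route-#1 side letters, offset
        (c' t ε₁ θ γ₃ l₁ : ℝ)
        (sel : ℕ → (B7Prop1Explicit.Site 4 → Fin 4 → (Matrix (Fin N) (Fin N) ℂ)ˣ) → (B7Prop1Explicit.Site 4 → Fin 4 → (Matrix (Fin N) (Fin N) ℂ)ˣ))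
        (rd : ι' → (B7Prop1Explicit.Site 4 → Fin 4 → (Matrix (Fin N) (Fin N) ℂ)ˣ)) (k₀ : ℕ)
        -- N17-side letters: infrared pin, β-window
        (gIR bβ : ℝ) (k₀β : ℕ),
        -- the run-B functional is the first-coupling family read through the selector
        EB = (fun s => R.u3.EB (bsel s) s) ∧
        -- (i) the ledger predicate for whatever size data and census constants meet their clauses
        (∀ (Sz : ℕ → ℝ → S.ι → ℕ → ℝ) (E₀ : ℝ) (m : ℕ) (a : ℝ) (Cw Λg : ℝ),
          (∀ K t, |t| ≤ S.l₀ → ∀ τ ∈ S.T K \ S.Bad K t, ∀ v ∈ Rd.dom, ∀ j ≤ K,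
            |∑ X ∈ L.fac K t τ with R.u3.C.scale X = j,
                (Real.log (Real.exp (EB (fun i => g (K + 1) (i + 1)) (uB K v) X
                    - EB (fun i => g (K + 1) (i + 1)) L.oneB X))
                  - Real.log (Real.exp (R.u3.EA (g K) (uA K v) X - R.u3.EA (g K) L.oneA X)))| ≤ Sz K t τ j) →
          0 ≤ E₀ → 0 < a → a < 1 →
          (∀ K t, |t| ≤ S.l₀ → ∀ τ ∈ S.T K \ S.Bad K t, ∀ j ≤ K,
            Sz K t τ j ≤ S.vol * (E₀ * ((K : ℝ) + 1) ^ m * a ^ (K - j))) →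
          (∀ K, Multiplicity (L.All K) R.u3.C.scale (fun X => Real.exp (-(R.u3.κ * R.u3.C.d X))) Cw S.vol Λg K) →
          (∀ K t, |t| ≤ S.l₀ → ∀ τ ∈ S.T K \ S.Bad K t,
            WindowMultiplicity (L.facO K t τ) L.scO L.wO Cw S.vol Λg (jlogOf L.Cl K) K) →
          1 ≤ Λg → L.θ' ≤ Λg →
          LedgerAtSync { L with S := Sz, E₀ := E₀, m := m, a := a, Cw := Cw, Λg := Λg } S.l₀ S.vol S.T S.Bad
            (fun K t τ => S.A K t τ - S.shA K t τ) (fun K t τ => S.B K t τ - S.shB K t τ) Rd R.u3.EA EB R.u3.κ g uA uB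
            R.u3.ω θc R.u3.θ θ₃) ∧
        0 ≤ S.vol ∧
        (∀ K t, |t| ≤ S.l₀ → ∀ τ ∈ S.T K \ S.Bad K t,
          WindowMultiplicity (L.facO K t τ) L.scO L.wO L.Cw S.vol L.Λg (jlogOf L.Cl K) K) ∧
        0 ≤ L.Cw ∧ 1 ≤ L.Λg ∧ L.θ' ≤ L.Λg ∧
        -- (ii-m) the reference ledger's lattice identification
        (∀ K, (Pf K).d = d₀) ∧ (∀ K, (Pf K).L = L₀) ∧ (∀ K, (Pf K).K = Koff + K) ∧
        (∀ K, (Fintype.card (Site (Pf K) (Pf K).K) : ℝ) = S.vol) ∧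
        kappa₀ (4 * 2 ^ d₀) (2 * d₀) ≤ R.u3.κ ∧
        (∀ K, ∀ X ∈ L.All K,
          (cells K (R.u3.C.scale X + Koff) X).Nonempty ∧ TFaceConnected (cells K (R.u3.C.scale X + Koff) X)) ∧
        (∀ K j, Set.InjOn (cells K j) ↑((L.All K).filter fun X => R.u3.C.scale X + Koff = j)) ∧
        (∀ K, ∀ X ∈ L.All K, torusTreeLen (cells K (R.u3.C.scale X + Koff) X) ≤ R.u3.C.d X) ∧
        -- (iii) [III] Theorem 2 (2.43) AS PRINTED with window letters
        B14.Thm2Printed H033 fam Lb β κ₁ ∧ β < 1 ∧ 0 < β ∧ 1 < Lb ∧ 1 ≤ Gv ∧ 0 ≤ Cl ∧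
        -- (iv) the positional-count half of N14's pinned pair at a rate `≤ R.ne1.Λ`
        (∀ p K, (R.ne1.𝒯.B p K).PositionalCount fun j k => N₀ * Λ₀ ^ (k - j)) ∧ 0 ≤ N₀ ∧ 0 ≤ Λ₀ ∧ Λ₀ ≤ R.ne1.Λ ∧
        -- (ii-v-A) run A's vacuum slices ↔ printed E-terms
        (∀ K t, |t| ≤ S.l₀ → ∀ τ ∈ S.T K \ S.Bad K t, ∀ v ∈ Rd.dom, ∀ j ≤ K, ∃ (i : I) (w : (fam i).Ω) (j' : ℕ),
          (fam i).flow.SatisfiesRG (fam i).K ∧ H033 (fam i).flow (fam i).K ∧ 1 ≤ j' ∧ j' ≤ (fam i).K ∧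
          (fam i).K - j' = K - j ∧ (fam i).K ≤ K + K₁ ∧
          (∀ n, 0 ≤ (fam i).gammaVol n w) ∧ (fam i).gammaVol (fam i).K w ≤ S.vol ∧
          (∀ n, n < (fam i).K → n < jlogOf Cl (fam i).K → (fam i).gammaVol n w = 0) ∧
          (∀ n, n < (fam i).K → jlogOf Cl (fam i).K ≤ n → (fam i).gammaVol n w ≤ S.vol * Gv ^ ((fam i).K - n)) ∧
          |∑ X ∈ (L.fac K t τ).filter (fun X => ¬ dressed X) with R.u3.C.scale X = j,
              (R.u3.EA (g K) (uA K v) X - R.u3.EA (g K) L.oneA X)| ≤ |(fam i).eTerm j' (fam i).K w|) ∧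
        -- (ii-v-B) run B's vacuum slices ↔ printed E-terms
        (∀ K t, |t| ≤ S.l₀ → ∀ τ ∈ S.T K \ S.Bad K t, ∀ v ∈ Rd.dom, ∀ j ≤ K, ∃ (i : I) (w : (fam i).Ω) (j' : ℕ),
          (fam i).flow.SatisfiesRG (fam i).K ∧ H033 (fam i).flow (fam i).K ∧ 1 ≤ j' ∧ j' ≤ (fam i).K ∧
          (fam i).K - j' = K - j ∧ (fam i).K ≤ K + K₁ ∧
          (∀ n, 0 ≤ (fam i).gammaVol n w) ∧ (fam i).gammaVol (fam i).K w ≤ S.vol ∧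
          (∀ n, n < (fam i).K → n < jlogOf Cl (fam i).K → (fam i).gammaVol n w = 0) ∧
          (∀ n, n < (fam i).K → jlogOf Cl (fam i).K ≤ n → (fam i).gammaVol n w ≤ S.vol * Gv ^ ((fam i).K - n)) ∧
          |∑ X ∈ (L.fac K t τ).filter (fun X => ¬ dressed X) with R.u3.C.scale X = j,
              (EB (fun i => g (K + 1) (i + 1)) (uB K v) X - EB (fun i => g (K + 1) (i + 1)) L.oneB X)|
            ≤ |(fam i).eTerm j' (fam i).K w|) ∧
        -- (ii-d) the dressed sub-ledger ↔ N14's bookings on `R.ne1.𝒯`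
        (∀ K t, |t| ≤ S.l₀ → ∀ τ ∈ S.T K \ S.Bad K t, ∀ v ∈ Rd.dom,
          ∃ (pA : R.ne1.P) (βA : R.u3.C.Dom → (R.ne1.𝒯.B pA K).Birth) (Q : Finset (R.ne1.𝒯.B pA K).Cube) (pB : R.ne1.P)
            (KB : ℕ) (βB : R.u3.C.Dom → (R.ne1.𝒯.B pB KB).Birth),
          (∀ X ∈ (L.fac K t τ).filter (fun X => dressed X), (R.ne1.𝒯.B pA K).birthScale (βA X) = R.u3.C.scale X) ∧
          (∀ j, Set.InjOn βA ↑(((L.fac K t τ).filter (fun X => dressed X)).filter fun X => R.u3.C.scale X = j)) ∧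
          (∀ c ∈ Q, (R.ne1.𝒯.B pA K).cubeScale c = K) ∧ ((Q.card : ℝ) ≤ S.vol) ∧
          (∀ X ∈ (L.fac K t τ).filter (fun X => dressed X), ∃ c ∈ Q, βA X ∈ (R.ne1.𝒯.B pA K).feltAt c) ∧
          (∀ X ∈ (L.fac K t τ).filter (fun X => dressed X), KB - (R.ne1.𝒯.B pB KB).birthScale (βB X) = K - R.u3.C.scale X) ∧
          (∀ X ∈ (L.fac K t τ).filter (fun X => dressed X),
            |R.u3.EA (g K) (uA K v) X - R.u3.EA (g K) L.oneA X| ≤ (R.ne1.𝒯.B pA K).size (βA X) K) ∧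
          (∀ X ∈ (L.fac K t τ).filter (fun X => dressed X),
            |EB (fun i => g (K + 1) (i + 1)) (uB K v) X - EB (fun i => g (K + 1) (i + 1)) L.oneB X|
              ≤ (R.ne1.𝒯.B pB KB).size (βB X) KB)) ∧
        -- (v′-16) N16 BY NAME: THE END's regime letters of `R.ne3`, N07's interface, the selection, NE7 route-#1's side letters, the
        -- reading map, the action-reading identification, the offset, the gauge-domination convention
        R.ne3.g = gradConst 4 c' ∧ 2 ≤ R.ne3.L ∧ 1 ≤ R.ne3.Nper ∧ 0 ≤ R.ne3.b ∧ 0 ≤ c' ∧ R.ne3.b ≤ t ∧ c' ≤ t ∧ 0 ≤ R.ne3.C ∧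
        (2 : ℝ) ^ 91 * (R.ne3.L : ℝ) ^ 17 * t ≤ 1 ∧ (2 : ℝ) ^ 76 * (R.ne3.L : ℝ) ^ 12 * t ≤ R.ne3.ε ∧
        16 * B7Prop2Explicit.C0 4 * R.ne3.ε ≤ 3 ∧ 1024 * (4 + 1) * (4 + 4) * (R.ne3.L : ℝ) ^ 2 * R.ne3.ε ≤ 1 ∧
        ε₁ ≤ 1 / 4 ∧ ε₁ ≤ R.ne3.b ∧ 4 * ε₁ ≤ c' ∧ R.ne3.dom ⊆ sfClass 4 R.ne3.L R.ne3.Nper ε₁ 0 ∧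
        LeafH3sup 4 R.ne3.L R.ne3.Nper R.ne3.ε R.ne3.b c' R.ne3.dom ∧
        (∀ V ∈ R.ne3.dom, ∀ k : ℕ, IsMinimiser 4 (sfClass 4 R.ne3.L R.ne3.Nper R.ne3.ε) R.ne3.L R.ne3.Nper k V (sel k V)) ∧
        (∀ V ∈ R.ne3.dom, ∀ k : ℕ, RegularSup 4 R.ne3.L R.ne3.Nper R.ne3.b c' k (sel k V)) ∧
        0 < θ ∧ θ ^ 6 = ((R.ne3.L : ℝ))⁻¹ ∧ 0 < R.ne3.Λ₂' ∧ 0 < γ₃ ∧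
        R.ne3.C * (wallConst 4 R.ne3.L * (R.ne3.Nper : ℝ) ^ 2 *
          (Real.sqrt (gradConst 4 c') * dualC2 4 R.ne3.L + 2 * R.ne3.b ^ 2 * dualC1 4 R.ne3.L)) ≤ γ₃ ^ 3 ∧
        0 < l₁ ∧ R.ne3.Λ₁ ≤ l₁ ^ 3 ∧ γ₃ * θ ^ 2 ≤ l₁ * R.ne3.Nper ∧ ((R.ne3.L : ℝ))⁻¹ ≤ θ₃ ∧ θ ^ 8 ≤ θ₃ ∧ θ₃ < 1 ∧
        (∀ v ∈ Rd.dom, rd v ∈ R.ne3.dom) ∧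
        (∀ k, ∀ v ∈ Rd.dom, Rd.act k v = minAct 4 (sfClass 4 R.ne3.L R.ne3.Nper R.ne3.ε) R.ne3.L R.ne3.Nper k (rd v)) ∧
        (R.ne3.Nper : ℝ) ^ 4 ≤ Rd.vol ∧ 1 ≤ k₀ ∧
        (∀ K : ℕ, ∀ v ∈ Rd.dom, ∀ (u : B7Prop1Explicit.Site 4 → (Matrix (Fin N) (Fin N) ℂ)ˣ)
          (Z : B7Prop1Explicit.Site 4 → Fin 4 → Matrix (Fin N) (Fin N) ℂ) (M : ℝ),
          IsUnitarySite u → IsPeriodicSite u ((R.ne3.Nper * R.ne3.L ^ (k₀ + K) : ℕ) : ℤ) → T4AveragingDeficitWall.IsSkewDir Z →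
          IsPeriodicDir Z ((R.ne3.Nper * R.ne3.L ^ (k₀ + K) : ℕ) : ℤ) →
          B7Prop1Explicit.gaugeAct u (sel (k₀ + K) (rd v)) =
            T4AveragingDeficitWall.vary (B7Prop2Explicit.rescale R.ne3.L (B7Prop1Explicit.bavg R.ne3.L (sel (k₀ + K + 1) (rd v)))) Z 1 →
          (∀ (x : B7Prop1Explicit.Site 4) (κ : Fin 4), ‖Z x κ‖ ≤ M) → R.u3.C.gauge (uA K v) (R.u3.C.transport (uB K v)) ≤ M) ∧
        -- letter signs
        0 ≤ R.u3.θ ∧ 0 ≤ R.u3.C₅ ∧ 0 ≤ R.u3.ω ∧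
        -- (v′-17) N17 BY NAME: the (0.20)-run identification, the infrared pin, (D4), the β-window, the smallness window, rates
        (∀ K, RGEqH K D.βfun (g K)) ∧ (∀ K, g K K = gIR) ∧ ReadOutAt D R.u3 ∧ 0 < bβ ∧
        EventualLowerH bβ R.u3.γ k₀β D.βfun ∧
        R.u3.cr * R.u3.C₉ * R.u3.ω * (((k₀β : ℝ) + 1) * R.u3.γ ^ 3 + 2 * R.u3.γ / bβ) ≤ (1 - R.u3.ρ) / 2 ∧
        0 < R.u3.ρ ∧ R.u3.ρ < 1 ∧ 0 < R.u3.γ ∧ R.u3.ρ ≤ θc ∧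
        -- the box, the bracket (T), window memberships, selector compatibility
        (∀ K i, i ≤ K → 0 < g K i ∧ g K i ≤ R.u3.γ) ∧
        LipBackground R.u3.EA R.u3.W R.u3.κ CU ∧ PolyLipGrowth CU g Pg q ∧ 0 ≤ Pg ∧
        (∀ K, g K ∈ R.u3.W) ∧ (∀ K, (fun i => g (K + 1) (i + 1)) ∈ R.u3.W) ∧
        (∀ s ∈ R.u3.W, 0 < bsel s ∧ bsel s ≤ R.u3.γ)) :
    ∀ (F : T4Continuum.T4Family) (D : YMDAG.UVSplit.Datum F N) (g₀ : ℕ → ℝ) (os : List (T4Continuum.ULoop F))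
      (S : SpineCarriers) (R : RateCarriers N), SRec F D g₀ os S → RRec F D g₀ os R → RatesAt D R → letI := S.dec
      ∃ δ : ℕ → ℝ, NE7.Core S.l₀ S.vol S.T S.Bad (fun K t τ => S.A K t τ - S.shA K t τ)
        (fun K t τ => S.B K t τ - S.shB K t τ) δ ∧ Summable δ := by
  intro F D g₀ os S R hS hR hrates
  letI := S.dec
  -- destructure the link reading IN STAGES (one flat 113-component `obtain` is quadratic in the pattern count: ≈ 14 min on the farm)
  obtain ⟨_, F', ι', X', _, L, Rd, bsel, EB, θc, θ₃, Pg, q, CU, g, uA, uB, hrest⟩ := hlink F D g₀ os S R hS hR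
  obtain ⟨Pf, d₀, L₀, Koff, cells, H033, I, fam, Lb, β, κ₁, Gv, Cl, K₁, Λ₀, N₀, dressed, _, hrest⟩ := hrest
  obtain ⟨c', t, ε₁, θ, γ₃, l₁, sel, rd, k₀, gIR, bβ, k₀β, hrest⟩ := hrest
  obtain ⟨hEB, hL, hvol, homult, hCw, hΛg, hθΛ, hPd, hPL, hPK, hcard, hκ₀, hdom, hinj, hlen, hrest⟩ := hrest
  obtain ⟨h11, hβ1, hβ0, hLb, hGv, hCl, hcount, hN₀, hΛ₀, hle, hidA, hidB, hidD, hrest⟩ := hrest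
  -- (v′-16)
  obtain ⟨hg3, hL2, hNper, hb, hc', hbt, hct, hC3, hsmall3, hεt, hε1, hε2, hε₁, hε₁b, hε₁c, hdom3, hH3, hsel, hreg, hrest⟩ := hrest
  obtain ⟨hθ0, hθ6, hΛ₂', hγ₃, hγ3, hl₁, hΛl₁, hfit, hθ₃L, hθ₃θ, hθ₃1, hrd, hact, hvol3, hk₀, hdomc, hrest⟩ := hrest
  -- signs, (v′-17), the box, (T), windows, selector
  obtain ⟨hθ, hC₅, hω, hrun, hpin, hD4, hbβ, hlo, hsmallβ, hρ0, hρ1, hγu, hρθc, hbox, hU, hG, hPg, hgA, hgB, hbsel⟩ := hrest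
  haveI : Nonempty (Fin N) := ⟨⟨0, Nat.pos_of_ne_zero (NeZero.ne N)⟩⟩
  -- N14 · N18 · N22 from `RatesAt D R` by name (as in gen 3)
  have h14 : DressedStabilityStrict R.ne1.𝒯 R.ne1.Λ := dressedStabilityStrict_of_n14At hrates.1
  have h18 : NE5 R.u3.EA EB R.u3.W R.u3.κ R.u3.θ R.u3.C₅ := by
    rw [hEB]; exact ne5_of_n18At R.u3 hrates.2.2.2.2.1 bsel hbsel
  have h22 : NE9 R.u3.EA R.u3.W R.u3.κ R.u3.Λ ∧ T4OutputRate.FadingMemory R.u3.C₉ R.u3.ω R.u3.Λ := hrates.2.2.2.2.2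
  -- N16 from `RatesAt D R` by name: the covariant root at the bundle, read with `R.ne3.g = gradConst 4 c′`
  have h16 : NE3EnergyWeightedCovShape.NE3EnergyRateWCov 4 (sfClass 4 R.ne3.L R.ne3.Nper R.ne3.ε) R.ne3.L R.ne3.Nper R.ne3.b
      (gradConst 4 c') R.ne3.C R.ne3.Λ₁ R.ne3.Λ₂' R.ne3.dom := by
    rw [← hg3]; exact hrates.2.2.1
  obtain ⟨C₃, loc, hC₃, h16', hgd⟩ :=
    ne3Liaison_of_covRoot (n := Fin N) hL2 hNper hb hc' hbt hct hC3 hsmall3 hεt hε1 hε2 hε₁ hε₁b hε₁c hdom3 h16 hH3 sel hsel hreg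
      hθ0 hθ6 hΛ₂' hγ₃ hγ3 hl₁ hΛl₁ hfit hθ₃L hθ₃θ hθ₃1 Rd rd hrd hact hvol3 uA uB hk₀ hdomc
  -- N17 from `RatesAt D R` by name: node U2's output on the tables, companions from (D4) · N18 · N22, worsened to the record's rate `θc`
  have hc17 : 0 ≤ R.u3.cr * R.u3.C₅ * R.u3.θ :=
    (N19InEdgesAtRecord.histCompanions_of_readOutAt D hD4 hrates.2.2.2.2.1 hrates.2.2.2.2.2).2.2.1
  have hCd : 0 ≤ 2 * (R.u3.cr * R.u3.C₅ * R.u3.θ) / (1 - R.u3.ρ) := div_nonneg (mul_nonneg zero_le_two hc17) (by linarith)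
  have hinj17 : InjectedRate (2 * (R.u3.cr * R.u3.C₅ * R.u3.θ) / (1 - R.u3.ρ)) 0 θc
      (fun K j => T4CouplingMatching.disc (g K) (g (K + 1)) j) :=
    (injectedRate_of_n17At_readOutAt D hrates.2.2.2.1 hD4 hrates.2.2.2.2.1 hrates.2.2.2.2.2 hγu hbβ hρ0 hρ1 hrun hbox hpin hlo
      hsmallβ).mono_rate hCd hρ0.le hρθc
  have hθc : 0 ≤ θc := hρ0.le.trans hρθc
  -- knit v6 on the re-localised readings family (the ledger predicate transfers: `ledgerAtSync_withLoc`)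
  exact core_summable_of_ledgerAtSync_multByName (R := (⟨Rd.dom, Rd.act, loc, Rd.vol, Rd.vol_nonneg⟩ : Readings ι' Unit))
    (fun Sz E₀ m a Cw Λg hSz hE₀ ha0 ha1 hSle hm hom hΛ1 hθΛ' =>
      ledgerAtSync_withLoc (hL Sz E₀ m a Cw Λg hSz hE₀ ha0 ha1 hSle hm hom hΛ1 hθΛ') loc)
    hvol homult hCw hΛg hθΛ Pf hPd hPL hPK hcard hκ₀ cells hdom hinj hlen H033 fam h11 hβ1 hβ0 hLb hGv hCl K₁ ⟨h14, hcount⟩ hN₀ hΛ₀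
    hle dressed hidA hidB hidD h16' hC₃ hgd h18 hθ hC₅ h22 hω hinj17 hCd hθc hbox hU hG hPg hgA hgB

end Edge

end Summit.QuantumFields.YangMills.BalabanUVNodes.N19RateEdgeByName

end
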